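import Mathlib.Analysis.Calculus.FDeriv.CompCLM
import Mathlib.Analysis.InnerProductSpace.Adjoint
import Literature.MathematicalPhysics.QuantumLattice.YangMillsClassical
import HarnessLib

/-!
# Frame independence of the Yang–Mills density (discharge of `ymDensity_eq_of_orthonormalBasis`)

Trunk `QLatticeAQFT`, topic `MathematicalPhysics/QuantumLattice`. Sibling proof file of
`Literature/MathematicalPhysics/QuantumLattice/YangMillsClassical.lean`: it discharges the named
fact `Literature.MathematicalPhysics.QuantumLattice.ymDensity_eq_of_orthonormalBasis` of that file. No statement is introduced or
changed; the helper lemmas below are elementary (Parseval) and carry their own docstrings.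

## The fact and its source

Jaffe–Witten, *Quantum Yang–Mills theory* (Clay problem description, 2000), §1, p. 2, eq. (1):
the classical action is `L = (1/4g²) ∫ Tr F ∧ *F`, "where `Tr` denotes an invariant quadratic
form on the Lie algebra of `G`", with `F = dA + A ∧ A` (pp. 1–2). The integrand `Tr F ∧ *F =
|F|² dvol` is intrinsic; in an orthonormal frame `e` it reads `|F(x)|² = ∑_{i<j} |F(x)(eᵢ,eⱼ)|²`,
which is how `Literature.MathematicalPhysics.QuantumLattice.ymDensity` / `Literature.MathematicalPhysics.QuantumLattice.ymDensityOfBasis` define the density (for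
`𝔸 = M_N(ℂ)` with the Frobenius = Hilbert–Schmidt norm, `|X|² = tr X*X`, an `Ad U(N)`-invariant
quadratic form). The vendored fact `ymDensity_eq_of_orthonormalBasis` is the statement that this
frame expression does not depend on the orthonormal frame, at every point where the connection
is differentiable. [cite: JaffeWitten2000, §1 eq. (1)]

## Proof

* `curvature_eq_of_differentiableAt`, `exists_bilin_eq_curvature`: at a point `x` with
  `DifferentiableAt ℝ A x` one has `∂ᵤ(A·v)(x) = (DA(x)u)v` (Mathlib `fderiv_clm_apply`), so
  `F_A(x)(u,v) = (DA(x)u)v − (DA(x)v)u + [A_u(x), A_v(x)]` is a bilinear map `E →ₗ E →ₗ 𝔸`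
  (any coefficient algebra `𝔸`).
* `ymDensityOfBasis_eq_half_sum`: by antisymmetry (`curvature_antisymm`, `curvature_self`),
  `∑_{i<j} ‖F(bᵢ,bⱼ)‖² = ½ ∑_{i,j} ‖F(bᵢ,bⱼ)‖²` (any norm).
* `sum_sq_norm_apply_eq_sum_sq_norm_adjoint`, `sum_sq_norm_apply_orthonormalBasis`: for a linear
  map `T : E → G` of finite-dimensional real inner product spaces, Parseval
  (`OrthonormalBasis.sum_sq_inner_left/right`) gives `∑ᵢ ‖T bᵢ‖² = ∑ₖ ‖T† eₖ‖²`, hence the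
  Hilbert–Schmidt sum `∑ᵢ ‖T bᵢ‖²` is frame independent.
* `frobenius_norm_sq_eq_sum`, `sum_sq_frobenius_norm_apply_orthonormalBasis`,
  `sum_sum_sq_frobenius_norm_apply₂_orthonormalBasis`: the Frobenius norm is `‖M‖² = ∑ₖₗ |Mₖₗ|²`
  and each entry is an `ℝ`-linear map into the real inner product space `ℂ`, so the previous
  step transfers to `M_{m×n}(ℂ)`-valued linear and then (fibrewise, via `LinearMap.flip`)
  bilinear maps. The printed matrix counterpart is the unitary invariance of `∑ |aᵢⱼ|²`,
  Horn–Johnson, *Matrix Analysis* (2nd ed. 2013), Theorem 2.2.2; §5.6 ("the Frobenius and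
  spectral norms are unitarily invariant").
* `ymDensity_eq_of_orthonormalBasis_holds` assembles the three steps.

## Mathlib search

Mathlib has Parseval for orthonormal bases (`OrthonormalBasis.sum_sq_inner_right`,
`OrthonormalBasis.sum_sq_inner_left`, `Mathlib/Analysis/InnerProductSpace/PiL2.lean`), the
finite-dimensional adjoint (`LinearMap.adjoint_inner_right`), `LinearMap.trace_eq_sum_inner`,
the Frobenius norm (`Matrix.frobenius_norm_def`, scoped instance `Matrix.Norms.Frobenius`) and
`Matrix.entryLinearMap`; it has no Hilbert–Schmidt norm of (bi)linear maps between inner product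
spaces and no frame-independence lemma for `∑ᵢ ‖T bᵢ‖²` (`rg "HilbertSchmidt|hilbertSchmidt"`:
nothing). `Literature/Analysis/FluidPDE/VectorCalculus.lean` proves the linear-map case as
`Literature.Analysis.FluidPDE.sum_norm_sq_apply_eq_trace` via `LinearMap.trace`; we give the three-line Parseval
proof here instead of importing the fluid-PDE prelude into the gauge-theory topic.
-/

noncomputable section

open scoped RealInnerProductSpace
open Module

namespace Literature.MathematicalPhysics.QuantumLattice

section General

variable {E : Type*} [NormedAddCommGroup E] [InnerProductSpace ℝ E]
variable {𝔸 : Type*} [NormedRing 𝔸] [NormedAlgebra ℝ 𝔸]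

/-- At a point of differentiability of the connection, the derivative of the component
`y ↦ A_v(y)` is the evaluation of the total derivative: `∂ᵤ A_v (x) = (DA(x) u) v`. [folklore] -/
theorem fderiv_connection_apply (A : Connection E 𝔸) {x : E} (hA : DifferentiableAt ℝ A x)
    (u v : E) : fderiv ℝ (fun y => A y v) x u = fderiv ℝ A x u v := by
  rw [fderiv_clm_apply hA (differentiableAt_const v)]
  simp

/-- At a point `x` where `A` is differentiable,
`F_A(x)(u,v) = (DA(x) u) v − (DA(x) v) u + [A_u(x), A_v(x)]`. [folklore] -/
theorem curvature_eq_of_differentiableAt (A : Connection E 𝔸) {x : E}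
    (hA : DifferentiableAt ℝ A x) (u v : E) :
    curvature A x u v = fderiv ℝ A x u v - fderiv ℝ A x v u + (A x u * A x v - A x v * A x u) := by
  rw [curvature, fderiv_connection_apply A hA, fderiv_connection_apply A hA, Ring.lie_def]

/-- At a point `x` where `A` is differentiable the curvature `F_A(x)` is a bilinear map
`E × E → 𝔸` (Donaldson–Kronheimer §2.1: `F_A ∈ Ω²(𝔤)`). [folklore] -/
theorem exists_bilin_eq_curvature (A : Connection E 𝔸) {x : E} (hA : DifferentiableAt ℝ A x) :
    ∃ F : E →ₗ[ℝ] E →ₗ[ℝ] 𝔸, ∀ u v, F u v = curvature A x u v := by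
  refine ⟨LinearMap.mk₂ ℝ (fun u v => curvature A x u v) ?_ ?_ ?_ ?_, fun u v => rfl⟩
  · intro u₁ u₂ v
    simp only [curvature_eq_of_differentiableAt A hA, map_add, add_apply,
      add_mul, mul_add]
    abel
  · intro c u v
    simp only [curvature_eq_of_differentiableAt A hA, map_smul, smul_apply,
      smul_mul_assoc, mul_smul_comm, smul_sub, smul_add]
  · intro u v₁ v₂
    simp only [curvature_eq_of_differentiableAt A hA, map_add, add_apply,
      add_mul, mul_add]
    abel
  · intro c u v
    simp only [curvature_eq_of_differentiableAt A hA, map_smul, smul_apply,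
      smul_mul_assoc, mul_smul_comm, smul_sub, smul_add]

/-- The strictly upper-triangular frame sum is half the full double sum:
`∑_{i<j} ‖F(bᵢ,bⱼ)‖² = ½ ∑_{i,j} ‖F(bᵢ,bⱼ)‖²` (antisymmetry of `F`; any norm). [folklore] -/
theorem ymDensityOfBasis_eq_half_sum {ι : Type*} [Fintype ι] [LinearOrder ι]
    (b : OrthonormalBasis ι ℝ E) (A : Connection E 𝔸) (x : E) :
    ymDensityOfBasis b A x = (∑ i, ∑ j, ‖curvature A x (b i) (b j)‖ ^ 2) / 2 := by
  unfold ymDensityOfBasis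
  set f : ι → ι → ℝ := fun i j => ‖curvature A x (b i) (b j)‖ ^ 2 with hf
  have hsymm : ∀ i j, f i j = f j i := fun i j => by
    simp only [hf, curvature_antisymm A x (b i) (b j), norm_neg]
  have hdiag : ∀ i, f i i = 0 := fun i => by simp [hf]
  have hsplit : ∑ i, ∑ j, f i j =
      ∑ i, ∑ j, (if i < j then f i j else 0) + ∑ i, ∑ j, (if j < i then f i j else 0) := by
    rw [← Finset.sum_add_distrib]
    refine Finset.sum_congr rfl fun i _ => ?_
    rw [← Finset.sum_add_distrib]
    refine Finset.sum_congr rfl fun j _ => ?_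
    rcases lt_trichotomy i j with hij | rfl | hij
    · rw [if_pos hij, if_neg (not_lt.mpr hij.le), add_zero]
    · rw [if_neg (lt_irrefl _), hdiag, add_zero]
    · rw [if_neg (not_lt.mpr hij.le), if_pos hij, zero_add]
  have hswap : ∑ i, ∑ j, (if j < i then f i j else 0) = ∑ i, ∑ j, (if i < j then f i j else 0) := by
    rw [Finset.sum_comm]
    refine Finset.sum_congr rfl fun i _ => Finset.sum_congr rfl fun j _ => ?_
    rw [hsymm j i]
  change ∑ i, ∑ j, (if i < j then f i j else 0) = (∑ i, ∑ j, f i j) / 2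
  rw [hsplit, hswap]
  ring

end General

/-! ### Hilbert–Schmidt sums over orthonormal frames -/

section HilbertSchmidt

variable {E : Type*} [NormedAddCommGroup E] [InnerProductSpace ℝ E] [FiniteDimensional ℝ E]
variable {G : Type*} [NormedAddCommGroup G] [InnerProductSpace ℝ G] [FiniteDimensional ℝ G]

/-- Parseval twice: for a linear map `T : E → G` between finite-dimensional real inner product
spaces and orthonormal bases `c` of `E`, `e` of `G`, `∑ᵢ ‖T cᵢ‖² = ∑ₖ ‖T† eₖ‖²`
(`‖T cᵢ‖² = ∑ₖ ⟪T cᵢ, eₖ⟫² = ∑ₖ ⟪cᵢ, T† eₖ⟫²`, then `∑ᵢ ⟪cᵢ, w⟫² = ‖w‖²`). [folklore] -/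
theorem sum_sq_norm_apply_eq_sum_sq_norm_adjoint {κ κ' : Type*} [Fintype κ] [Fintype κ']
    (c : OrthonormalBasis κ ℝ E) (e : OrthonormalBasis κ' ℝ G) (T : E →ₗ[ℝ] G) :
    ∑ i, ‖T (c i)‖ ^ 2 = ∑ k, ‖LinearMap.adjoint T (e k)‖ ^ 2 := by
  calc ∑ i, ‖T (c i)‖ ^ 2
      = ∑ i, ∑ k, ⟪c i, LinearMap.adjoint T (e k)⟫ ^ 2 := by
        refine Finset.sum_congr rfl fun i _ => ?_
        rw [← e.sum_sq_inner_left (T (c i))]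
        simp_rw [LinearMap.adjoint_inner_right]
    _ = ∑ k, ‖LinearMap.adjoint T (e k)‖ ^ 2 := by
        rw [Finset.sum_comm]
        simp_rw [c.sum_sq_inner_right]

/-- For a linear map `T : E → G` between finite-dimensional real inner product spaces, the
Hilbert–Schmidt sum `∑ᵢ ‖T bᵢ‖²` is the same for all orthonormal bases `b` of `E`. [folklore] -/
theorem sum_sq_norm_apply_orthonormalBasis {ι ι' : Type*} [Fintype ι] [Fintype ι']
    (b : OrthonormalBasis ι ℝ E) (b' : OrthonormalBasis ι' ℝ E) (T : E →ₗ[ℝ] G) :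
    ∑ i, ‖T (b i)‖ ^ 2 = ∑ i', ‖T (b' i')‖ ^ 2 := by
  rw [sum_sq_norm_apply_eq_sum_sq_norm_adjoint b (stdOrthonormalBasis ℝ G) T,
    sum_sq_norm_apply_eq_sum_sq_norm_adjoint b' (stdOrthonormalBasis ℝ G) T]

end HilbertSchmidt

section Frobenius

open scoped Matrix.Norms.Frobenius

variable {E : Type*} [NormedAddCommGroup E] [InnerProductSpace ℝ E] [FiniteDimensional ℝ E]
variable {m n : Type*} [Fintype m] [Fintype n]

/-- The squared Frobenius norm is the sum of the squared moduli of the entries,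
`‖M‖² = ∑ₖₗ |Mₖₗ|²` (Horn–Johnson (2013) §5.6, the `l₂` / Frobenius norm). [folklore] -/
theorem frobenius_norm_sq_eq_sum (M : Matrix m n ℂ) : ‖M‖ ^ 2 = ∑ k, ∑ l, ‖M k l‖ ^ 2 := by
  rw [Matrix.frobenius_norm_def, ← Real.sqrt_eq_rpow,
    Real.sq_sqrt (Finset.sum_nonneg fun i _ => Finset.sum_nonneg fun j _ => by positivity)]
  simp_rw [Real.rpow_two]

omit [FiniteDimensional ℝ E] in
/-- Entrywise expansion of a Frobenius Hilbert–Schmidt sum: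
`∑ᵢ ‖T cᵢ‖² = ∑ₖₗ ∑ᵢ |(T cᵢ)ₖₗ|²`. [folklore] -/
theorem sum_sq_frobenius_norm_apply_eq {κ : Type*} [Fintype κ] (c : OrthonormalBasis κ ℝ E)
    (T : E →ₗ[ℝ] Matrix m n ℂ) :
    ∑ i, ‖T (c i)‖ ^ 2 = ∑ k, ∑ l, ∑ i, ‖(Matrix.entryLinearMap ℝ ℂ k l ∘ₗ T) (c i)‖ ^ 2 := by
  simp_rw [LinearMap.comp_apply, Matrix.entryLinearMap_apply, frobenius_norm_sq_eq_sum]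
  rw [Finset.sum_comm]
  exact Finset.sum_congr rfl fun k _ => Finset.sum_comm

/-- Hilbert–Schmidt sums of matrix-valued linear maps (Frobenius norm on `M_{m×n}(ℂ)`) do not
depend on the orthonormal frame: `∑ᵢ ‖T bᵢ‖² = ∑ᵢ ‖T b'ᵢ‖²`. [folklore] -/
theorem sum_sq_frobenius_norm_apply_orthonormalBasis {ι ι' : Type*} [Fintype ι] [Fintype ι']
    (b : OrthonormalBasis ι ℝ E) (b' : OrthonormalBasis ι' ℝ E) (T : E →ₗ[ℝ] Matrix m n ℂ) :
    ∑ i, ‖T (b i)‖ ^ 2 = ∑ i', ‖T (b' i')‖ ^ 2 := by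
  rw [sum_sq_frobenius_norm_apply_eq b, sum_sq_frobenius_norm_apply_eq b']
  exact Finset.sum_congr rfl fun k _ => Finset.sum_congr rfl fun l _ =>
    sum_sq_norm_apply_orthonormalBasis b b' _

/-- Frame independence of the full Hilbert–Schmidt double sum of a matrix-valued bilinear map
(Frobenius norm): `∑ᵢⱼ ‖B(bᵢ,bⱼ)‖² = ∑ᵢⱼ ‖B(b'ᵢ,b'ⱼ)‖²`. [folklore] -/
theorem sum_sum_sq_frobenius_norm_apply₂_orthonormalBasis {ι ι' : Type*} [Fintype ι]
    [Fintype ι'] (b : OrthonormalBasis ι ℝ E) (b' : OrthonormalBasis ι' ℝ E)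
    (B : E →ₗ[ℝ] E →ₗ[ℝ] Matrix m n ℂ) :
    ∑ i, ∑ j, ‖B (b i) (b j)‖ ^ 2 = ∑ i', ∑ j', ‖B (b' i') (b' j')‖ ^ 2 := by
  calc ∑ i, ∑ j, ‖B (b i) (b j)‖ ^ 2
      = ∑ i, ∑ j', ‖B (b i) (b' j')‖ ^ 2 :=
        Finset.sum_congr rfl fun i _ => sum_sq_frobenius_norm_apply_orthonormalBasis b b' (B (b i))
    _ = ∑ j', ∑ i, ‖B.flip (b' j') (b i)‖ ^ 2 := by rw [Finset.sum_comm]; rfl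
    _ = ∑ j', ∑ i', ‖B.flip (b' j') (b' i')‖ ^ 2 :=
        Finset.sum_congr rfl fun j' _ =>
          sum_sq_frobenius_norm_apply_orthonormalBasis b b' (B.flip (b' j'))
    _ = ∑ i', ∑ j', ‖B (b' i') (b' j')‖ ^ 2 := by rw [Finset.sum_comm]; rfl

end Frobenius

/-! ### The discharge -/

section MatrixGauge

open scoped Matrix.Norms.Frobenius

variable {E : Type*} [NormedAddCommGroup E] [InnerProductSpace ℝ E] [FiniteDimensional ℝ E]
variable {N : ℕ}

/-- Discharge of the named fact `ymDensity_eq_of_orthonormalBasis`: for the Frobenius norm on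
`M_N(ℂ)` and a connection `A` differentiable at `x`, the Yang–Mills density
`∑_{i<j} ‖F_A(x)(bᵢ,bⱼ)‖²` is the same in every orthonormal frame `b` of `E` (it is half the
squared Hilbert–Schmidt norm of the bilinear map `F_A(x)`), i.e. the frame expression of the
intrinsic integrand `Tr F ∧ *F` of Jaffe–Witten (2000), §1, p. 2, eq. (1).
[cite: JaffeWitten2000, §1 eq. (1)] -/
theorem ymDensity_eq_of_orthonormalBasis_holds :
    ymDensity_eq_of_orthonormalBasis (E := E) (N := N) := by
  intro ι _ _ b A x hA
  obtain ⟨F, hF⟩ := exists_bilin_eq_curvature A hA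
  rw [ymDensity, ymDensityOfBasis_eq_half_sum, ymDensityOfBasis_eq_half_sum]
  simp_rw [← hF]
  rw [sum_sum_sq_frobenius_norm_apply₂_orthonormalBasis (stdOrthonormalBasis ℝ E) b F]

end MatrixGauge

end Literature.MathematicalPhysics.QuantumLattice
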